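import Mathlib
import HarnessLib
import HarnessLib.Audit
import Summits.KontsevichZagierPeriods.Statement
import Literature.NumberTheory.Transcendental.KZKernelConjectureForms
import Literature.NumberTheory.Transcendental.KZLogCalculusProofs
import Literature.NumberTheory.Transcendental.KZRulesAssociator
import Literature.NumberTheory.Transcendental.KZRelationsLE
import Literature.NumberTheory.Transcendental.LindemannWeierstrassProofs
import HarnessLib.Audit.Status.Attr

/-!
Route: RootDecompFiniteDefect

# Route RootDecompFiniteDefect — KZ equals finitely many missing identities over the point classes
plus cancellation by polynomials in pi

It suffices to show X = FiniteDefect ∧ ElementaryCancellation, and X is EQUIVALENT to the summit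
(`summit_iff_split`, kernel-checked in
the draft file HOME/decomp-kz-lens-5/FiniteDefect.lean, rc 0, 0 sorry): the root node of the
decomposition cell decomp-kz, lens «finite
range + asymptotic regime (known theorem) + bridging lemma». Work in Kontsevich–Zagier's formal
period ring P = `KZ.FormalPeriodRing`
(= FormalRep ⧸ relations, KZ 2001 §4.1) with its evaluation `KZ.evalP : P →+* ℝ`; the summit is
injectivity of evalP (cited frame
`kzKernelConjecture_iff_isRational`). FiniteDefect (A) = the defect ideal ker evalP is spanned, as a
module over the point classes
Kpt = Subring.closure {⟦[pt, α]⟧ : α real algebraic} ≅ ℚ̄ ∩ ℝ, by FINITELY MANY vanishing formal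
periods (finitely many independent missing
identities). ElementaryCancellation (B) = every element of ℚ̄[⟦π⟧] ⊆ P of non-zero value is a
non-zero-divisor of P. The seam A ∧ B ⟹ S is
a theorem (Cayley–Hamilton + Lindemann), proved inside `closes`.
ROOT DECOMPOSITION CELL decomp-kz (D-0178), generation 0, node E = lens-5 «FiniteDefect»
(HOME/decomp-kz-lens-5/FiniteDefect.lean v1.2 sha256
f11629bd7a3275ada2561398819509ef3eee0cb76011ed1c21d1b48e399f74d4 (v1 a75b2585…, v1.1 a3f1e742…;
pieces byte-identical across versions): `summit_iff_split` S ⟺ A ∧ B, `closes`, both `_of_summit`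
necessity theorems, the §5 torsion square, the no-go `summit_iff_finitelyManyMasterIdentities`; rc
0, 0 sorry, 0 warnings, std axioms), CLEARED by the critic decomp-kz-crit-1 v1 2026-08-30T01:43:51Z
and CONFIRMED v1.1 2026-08-30T01:44:38Z (HOME/STATUS.md; HOME/CRITIC-LEDGER.md row «lens-5
FiniteDefect v1»; probe HOME/critic/L5_FiniteDefect_v1_probe.lean rc 0, std axioms) as an exact
2-piece AND-node with a PROVED seam (Cayley–Hamilton `LinearMap.exists_monic_and_aeval_eq_zero` on
the module-finite defect + Lindemann `transcendental_pi_holds`, PROVED — no named-fact hypothesis),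
ONE cited EQUIV frame S ↔ Injective KZ.evalP (`kzKernelConjecture_iff_isRational` +
`KontsevichZagierPeriods_iff`) with the AND beneath (admissible: the split beneath carries two
WEAKER pieces). Kernel identity of record (critic probe, adopted by lens v1.2 §5): S ⟺ TorsionDefect
∧ ElementaryCancellation, TorsionDefect := ∀ x, evalP x = 0 → ∃ p ∈ Kpt[X] monic, p(⟦π⟧)·x = 0, fed
by A (C–H half) and by item 0541 PiLocalKernel (p = X^N): this node and AyoubSpecialisation (EQ6: S
⟺ 0541 ∧ 0540) are the two diagonals of ONE 2×2 square {kernel side: PiLocalKernel | FiniteDefect ⟹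
TorsionDefect} × {cancellation side: ElementaryCancellation ⟹ PiCancellation}. Filed by the cell
writer decomp-kz-writer-1 as an OR-sibling of RootDecompDescentLadder /
RootDecompRelativeOneConservativity / RootDecompDimensionDescent / RootDecompRationalCubeDichotomy
(native `closes` certification rc 0; BC2 C → S probes FAIL 2/2; BC7 2/2 CLEAN; tribunal pre-check
recorded in the writer folder). Tags: A FiniteDefect WEAKER·IDEA-NEEDED+INSTRUMENTABLE(locating F)
(NEW) · B ElementaryCancellation WEAKER·IDEA-NEEDED (NEW; ⟹ 0540). census of record
HOME/census/COSTUME-CENSUS-v1.md sha256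
d820a1ccef7038cf1cf2195521173f232f3fb9dc74eaa204c7dee97b259d5198 (json
b41930f92fedc36ffa76fd1e9f0034d3b117c647635515f1ba8fb90c700a24cf) (rows EQ2, EQ6, R1–R3, P1 map the
pieces; the ℤ/ℚ finite-range no-go goes to the NOT-WEAKER list). WHY THIS IS NOVEL: the first split
of this summit by the SIZE of the defect rather than by a sector or a grading — «finitely many
independent missing identities over the point classes» plus cancellation by polynomials in π — whose
seam is a genuine theorem (Cayley–Hamilton + Lindemann) rather than modus ponens, with the
coefficient boundary (ℤ/ℚ versions ≡ S, ℚ̄ ∩ ℝ honest) proved. Rung currency: rung 0 — nothing here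
proves the summit.
Lean:
`Summit.KontsevichZagierPeriods.KontsevichZagierPeriods.Theses.RootDecompFiniteDefect.FiniteDefect ∧
Summit.KontsevichZagierPeriods.KontsevichZagierPeriods.Theses.RootDecompFiniteDefect.ElementaryCancellation`

## Assembly
Not modus ponens: let N = span_Kpt F; by A and the ideal property N = ker evalP, N is module-finite
over Kpt and stable under x ↦ ⟦π⟧·x;
Cayley–Hamilton over the commutative ring Kpt (LinearMap.exists_monic_and_aeval_eq_zero applied to
the restriction of mulLeft ⟦π⟧) gives a monic
p ∈ Kpt[X] with p(⟦π⟧)·N = 0; p(⟦π⟧) lies in ℚ̄[⟦π⟧] and evalP p(⟦π⟧) = p̄(π) ≠ 0 since p̄ is monic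
over ℚ̄ ∩ ℝ and π is transcendental over ℚ̄
(transcendental_pi_holds + Transcendental.subalgebraAlgebraicClosure); B cancels p(⟦π⟧), so N = 0,
evalP is injective, and the cited frame
kzKernelConjecture_iff_isRational + KontsevichZagierPeriods_iff + KZ.toFormalPeriod_eq_zero_iff
gives the summit (`closes`, both binders consumed,
axioms propext/Classical.choice/Quot.sound). Conversely S ⟹ A (F = ∅) and S ⟹ B (a subring of ℝ has
no zero-divisors): `summit_iff_split`.

Rationale: WHY THIS LINE. Every literal «finite range + asymptotic regime» instantiation on PAIRS of
representations is a costume on this summit (the high-complexity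
cell is absorbing by padding r ↦ r × [0,1]; dimension cuts are the KzOnePeriods / AbelContraction
ladders whose complements are ≡ S), and with
INTEGER or RATIONAL coefficients «all identities follow from finitely many master identities» is
itself ≡ S (`summit_iff_finitelyManyMasterIdentities`,
proved in the draft: the defect is 2-divisible because (m+1)·⟦[pt,1/(m+1)]⟧ = 1, Nakayama over ℤ, P
torsion-free). The first honest version takes
ALGEBRAIC coefficients: A = dim over ℚ̄ of the defect is finite. Then commutative algebra supplies
the bridge for free — Cayley–Hamilton
(Mathlib `LinearMap.exists_monic_and_aeval_eq_zero`) on the module-finite, ⟦π⟧-stable defect gives a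
MONIC p ∈ ℚ̄[X] with p(⟦π⟧)·ker = 0, and the
«asymptotic regime handled by a known theorem» is Lindemann 1882 (`transcendental_pi_holds`, PROVED
in tree, BakerTNT1975 Thm 1.4): p(π) ≠ 0 —
so the only remaining input is cancellation by that one elementary element, piece B, which is
SoloBlind's cancellation conjunct (C) shrunk to
ℚ̄[π] and sits just above the recorded hard core π-cancellation (stmt-KontsevichZagierPeriods-0540).
Imported from: linear algebra over
commutative rings (characteristic polynomials of endomorphisms of finite modules) and classical
transcendence (Hermite–Lindemann); the
template «finitely many master identities generate all» is a THEOREM in the functional weight-2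
sibling (all functional equations of the
dilogarithm follow from the five-term relation, paper:w2261051777 p. 85) while its numerical shadow
is open (hard core 10550).

RANKED CRUXES. #2 FiniteDefect (crux) — [ROOT-DECOMP decomp-kz gen 0 · node E piece A · tag WEAKER —
S ⟹ A by `finiteDefect_of_summit` (F = ∅; HOME/decomp-kz-lens-5/FiniteDefect.lean v1.2 sha256
f11629bd7a3275ada2561398819509ef3eee0cb76011ed1c21d1b48e399f74d4 (v1 a75b2585…, v1.1 a3f1e742…;
pieces byte-identical across versions)); A ⟹ S NOT known and not ring-theoretic (lens square-zero
model P_num ⋉ ℚ̄ε has A, ¬S, ¬B [hand]); BC2 probe A → S FAILS; coefficient boundary confirmed by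
the critic: the ℤ- and ℚ-coefficient finite-range versions are ≡ S (lens no-go
`summit_iff_finitelyManyMasterIdentities` PROVED; census NOT-WEAKER list, critic w4), Kpt ≅ ℚ̄ ∩ ℝ
is the first honest coefficient ring · NECESSARY (binder hA of `closes`; hA supplies the
module-finite defect) · NEW · kernel identity of record: A ⟹ TorsionDefect
(`critic_torsion_of_finiteDefect`, lens v1.2 `torsionDefect_of_finiteDefect` = the Cayley–Hamilton
half) ⟸ item stmt-KontsevichZagierPeriods-0541 PiLocalKernel (`torsionDefect_of_piLocalKernel`, p =
X^N), and S ⟺ TorsionDefect ∧ ElementaryCancellation (`critic_node_iff_torsion` /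
`summit_iff_torsionSplit`) — the 2×2 square with AyoubSpecialisation (S ⟺ 0541 ∧ 0540); lens answer
to w3: attackable feeder of TorsionDefect = 0541, A = the MEASURABLE feeder · leaf IDEA-NEEDED +
INSTRUMENTABLE(locating F: census instrument I-A locates candidate master identities / lower-bounds
defect rank in truncations; it can never support finiteness) · census of record
HOME/census/COSTUME-CENSUS-v1.md sha256
d820a1ccef7038cf1cf2195521173f232f3fb9dc74eaa204c7dee97b259d5198 (json
b41930f92fedc36ffa76fd1e9f0034d3b117c647635515f1ba8fb90c700a24cf) · verdict: critic decomp-kz-crit-1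
CLEARED v1 2026-08-30T01:43:51Z and CONFIRMED v1.1 2026-08-30T01:44:38Z (HOME/STATUS.md;
HOME/CRITIC-LEDGER.md row «lens-5 FiniteDefect v1»; probe HOME/critic/L5_FiniteDefect_v1_probe.lean
rc 0, std axioms)] finitely many missing identities: there is a finite set F of formal periods of
value 0 such that every formal period of value 0 lies in the Kpt-submodule of P spanned by F, where
Kpt is the subring of P generated by the point classes ⟦[pt, α]⟧ (α real algebraic; = classes of
IntegralRep.unit.constMul α) — i.e. the defect ideal ker evalP is a finite-dimensional (ℚ̄ ∩
ℝ)-vector space; the summit says F = ∅ works. [difficulty: open-problem] (why it might fail: it can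
only fail together with the summit (S ⟹ it with F = ∅, finiteDefect_of_summit); as a TARGET it may
be as hard as S: no mechanism bounding the ℚ̄-rank of the defect is known, and over ℤ or ℚ the same
sentence is ≡ S (summit_iff_finitelyManyMasterIdentities).) [KontsevichZagier2001,
HuberMullerStach2017, paper:w2261051777, Yoshinaga2008]
#3 ElementaryCancellation (crux) — [ROOT-DECOMP decomp-kz gen 0 · node E piece B · tag WEAKER — S ⟹
B by `elementaryCancellation_of_summit`; B ⟹ KZ.PiCancellation = item
stmt-KontsevichZagierPeriods-0540 (registered hard core «Ayoub π-cancellation») by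
`piCancellation_of_elementaryCancellation`; SoloBlind (C) ⟹ B; B ⟹ S NOT known; BC2 probe B → S
FAILS · NECESSARY (binder hB; hB kills the module-finite defect p(⟦π⟧)·ker = 0 produced by
Cayley–Hamilton + Lindemann) · NEW as typed · leaf IDEA-NEEDED (hard-core class 0540 /
stubPiCancellation / betaCancellation rungs) · verdict: critic decomp-kz-crit-1 CLEARED v1
2026-08-30T01:43:51Z and CONFIRMED v1.1 2026-08-30T01:44:38Z (HOME/STATUS.md; HOME/CRITIC-LEDGER.md
row «lens-5 FiniteDefect v1»; probe HOME/critic/L5_FiniteDefect_v1_probe.lean rc 0, std axioms)]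
cancellation by elementary formal periods: every y in the subring of P generated by the point
classes and ⟦π⟧ = class of KZ.piRep (so y = a polynomial in ⟦π⟧ with real-algebraic point-class
coefficients) whose value evalP y is non-zero is a non-zero-divisor of P: x·y = 0 ⟹ x = 0. Implied
by SoloBlind's full cancellation (C); implies KZ.PiCancellation (hard core
stmt-KontsevichZagierPeriods-0540, the case y = ⟦π⟧); cancellation by non-zero integers and non-zero
algebraic constants is already proved (they are units of P). [difficulty: XL] (why it might fail:
fails only with the summit (S ⟹ it, elementaryCancellation_of_summit); as a target its first
instance ⟦π⟧·x = 0 ⟹ x = 0 is the open hard core 0540: a certificate for π·x ∼ 0 may use the extra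
dimension essentially, with no π-free certificate of bounded excursion.) [KontsevichZagier2001,
stmt-KontsevichZagierPeriods-0540, BakerTNT1975, HuberMullerStach2017]

TWO-LAYER PLAN. Foreseen glued splits (not filed now): ElementaryCancellation ⇐
PiPolynomialCancellation-by-degree is NOT a valid split (degree-one case =
hard core 0540 does not obviously give higher degree: p(⟦π⟧) does not factor over the real point
classes); the natural split is
ElementaryCancellation ⇐ (KZ.PiCancellation: ⟦π⟧ cancels) → (IrreducibleElementaryCancellation:
cancellation by p(⟦π⟧) for p irreducible over
ℚ̄ ∩ ℝ of degree 2, i.e. (⟦π⟧ − a)² + b² with a, b real algebraic) → ElementaryCancellation, glue =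
factorisation of monic real polynomials into
linear and irreducible quadratic factors over the real-closed field ℚ̄ ∩ ℝ plus closure of
non-zero-divisors under products. FiniteDefect ⇐
(FiniteDefectLE d for the images of FormalRep_{≤ d}, d = 1, 2, as INSTRUMENT rungs only — each is
implied by KZ_le d-type statements and is
not filed until the defect-rank census reports).

KILL CRITERIA. A refutation of either piece refutes the SUMMIT (S ⟹ A and S ⟹ B are proved), so the
route closes refuted:<Decl> together with the problem.
The route is retired not-a-thesis if someone proves A ⟹ S inside the calculus without a cancellation
input (then A is a costume; the square-zero
model P_num ⋉ ℚ̄ε says ring theory alone cannot) or proves KZ.PiCancellation ⟹ B (then B is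
re-ranked as the hard core 0540 verbatim and the
route is a line on the routes wanting 0540). It is superseded if SoloBlind's Cancellation (C) is
proved outright (then A alone ≡ S given C).

NOT DECOMPOSED YET. The degree split of ElementaryCancellation (above) waits for the first
π-cancellation certificate (0540 / stubPiCancellation / AyoubPiCancellation
lines own it); no FiniteDefectLE rungs are filed before the census; the choice of coefficient ring
is frozen at Kpt (the draft's seam lemmas are
stated for every subring R ≤ AlgValued = evalP⁻¹(ℚ̄), so a later re-cut to larger coefficients costs
nothing in Lean).

CHEAPEST FALSIFIER. Kernel + lookup, already run: (i) is A → S or B → S cheap/in tree? BC7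
`#h21_crux_probe … summit := KontsevichZagierPeriods` on both pieces:
VERDICT CLEAN ×2, P5 C→S not closed (bc/bc7.out.txt); must-fail probes `first | simpa | unfold;
simpa | aesop` fail (bc/probes_must_fail.lean);
(ii) is A ≡ S by a units/divisibility trick as over ℤ? No: non-zero algebraic constants are units of
Kpt itself, so Nakayama over Kpt gives
nothing (the ℤ-trick is exactly what summit_iff_finitelyManyMasterIdentities records); (iii) census
I-A at complexity ≤ (dim 2, degree 2,
height 4): if PSLQ finds vanishing combinations with NO bounded move certificate faster than
linearly in N, A is in trouble numerically (and
so is S).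

NUMBERS. Draft file: 426 lines, rc 0, 0 sorry, 8 s on the farm; 6 key theorems with standard axioms;
BC7 2/2 CLEAN (85 s); glue mock render rc 0, closes
axioms standard. Rungs in tree: cancellation by n+1 PROVED (isUnit_natCast_add_one /
mem_relations_of_nsmul_mem), by non-zero algebraic constants
PROVED (units), by ⟦π⟧ OPEN (0540; S ⟹ it proved: stubPiCancellation_of_summit,
betaCancellation_of_summit). Coefficient boundary: ℤ, ℚ ⟹ ≡ S
(proved / by hand); ℚ̄ ⟹ WEAKER.

DEFINITION REQUESTS. None: Kpt, ⟦π⟧ and ℚ̄[⟦π⟧] are spelled out with Subring.closure /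
Submodule.span over existing KZ declarations (IntegralRep.unit, constMul,
piRep, toFormalPeriod, of, evalP); no new notion.

Novelty: Searches (2026-08-30): tree `rg "Module.Finite|Submodule.span|exists_monic|charpoly|Cayley"
Summits/KontsevichZagierPeriods` (0 period-ring uses), `rg "FormalPeriodRing" Theses/`
(FurushoPentagon coefficients only), decomp-kz TREE.md lists (b)/(c)/(e) (no finiteness-shaped
node); corpus `lit search --hybrid "effective period algebra integral domain zero divisors
Kontsevich conjecture"` (10 hits, all generic: huber2022 pp 10–11, 121), `lit search --hybrid "all
functional equations of the dilogarithm follow from the five term relation"` (no KZ-side hit), `lit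
search "dilogarithm functional equations five-term relation" --source all` (local 10:
paper:w2261051777 p 85 = the functional sibling theorem; remote 19, none on period rings); galaxy
`lit galaxy search "functional equations of the dilogarithm|five term relation|5-term relation"
--star pdf` (On poly(ana)logs I arXiv:math/0008089, Nielsen polylogs pdf:8865625588807538120 —
functional side only); no hits for "finitely generated kernel period map" / "zero divisors formal
period ring" in corpus(fts+vec) and galaxy.
Nearest prior art found: KontsevichZagier2001 §4.1 (the ring P̃ and the question of its structure;
no finiteness statement); in tree SoloBlindSummitSplit (kz_iff_reduced_cancel_transcendental: R ∧ C
∧ T — C ⊋ B, T replaced here by the PROVED Lindemann theorem, R/D replaced by finiteness); hard core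
0540 (π-cancellation) as B's first instance; functional sibling paper:w2261051777 p 85 (dilog:
five-term generates all)  [refs: math/0008089, paper:w2261051777, KontsevichZagier2001]

Barriers (technique_class: commutative-algebra, cayley-hamilton, lindemann): - technique_class: commutative-algebra, cayley-hamilton, lindemann, period-ring
- Literature.Barriers.KontsevichZagierPeriods.noSemialgebraicPrimitive_inv_sub_two:
(AlgebraicPrimitivesObstruction, with algebraicPrimitivesObstructionNarrow) outside — both pieces
conclude membership / cancellation in the UNTRUNCATED quotient P = FormalRep ⧸ relations (all
dimensions, no relationsLE / EquivalentLE), so excursions through higher-dimensional certificates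
are allowed; the obstruction quantifies over fixed-arity primitive searches only.
- Literature.Barriers.KontsevichZagierPeriods.kzConjecture_implies_oddZetaAlgIndep:
(GrothendieckPeriodConjectureDependence, with kzConjecture_implies_twoPiI_log_algIndep and
kzConjecture_implies_ellipticPeriods_algIndep) B carries it openly for the single period π
(π-torsion-freeness of P is what GPC's torsor structure would give); A does not evade it either —
the bet is that finiteness of the defect is a strictly weaker, census-instrumentable shadow of
«defect = 0», and that the transcendence input the seam needs is only Lindemann, which is a theorem.
- Literature.Barriers.KontsevichZagierPeriods.cressonViuSos_prop_3_2: (HauptvermutungObstruction)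
untouched — no comparison between formalisms; everything is inside the one KZ calculus and its own
quotient ring.
- Literature.Barriers.KontsevichZagierPeriods.not_complete_of_undecidable:
(PeriodEqualityDecidability, with not_complete_of_undecidableNarrow) untouched — neither piece
decides equality; A wo

sub-problem: KontsevichZagierPeriods · status: open · opened planner-decomp-kz-writer-1-g0-0 2026-08-30T02:16:17Z · rev 0 · ledger route-KontsevichZagierPeriods-RootDecompFiniteDefect
GENERATED by the gate from the ledger (D-0016/17). Provers cite these decls: `theorem foo : Summit.KontsevichZagierPeriods.KontsevichZagierPeriods.Theses.RootDecompFiniteDefect.<Decl> := …` in Summits/KontsevichZagierPeriods/KontsevichZagierPeriods/Theorems/<Name>.lean.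
-/

namespace Summit.KontsevichZagierPeriods.KontsevichZagierPeriods.Theses.RootDecompFiniteDefect

open scoped BigOperators Topology Manifold Classical MeasureTheory ProbabilityTheory Matrix InnerProductSpace ComplexConjugate ContinuousMap
open Filter Set Function TopologicalSpace MeasureTheory

attribute [summit_statement] _root_.KontsevichZagierPeriods

open Literature Periods

/-- item stmt-KontsevichZagierPeriods-25042 · crux · rank 2 · open · by planner
why it might fail: it can only fail together with the summit (S ⟹ it with F = ∅, finiteDefect_of_summit); as a TARGET it may be as hard as S: no mechanism bounding the ℚ̄-rank of the defect is known, and over ℤ or ℚ the same sentence is ≡ S (summit_iff_finitelyManyMasterIdentities).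
sources: KontsevichZagier2001, HuberMullerStach2017, paper:w2261051777, Yoshinaga2008
[crux] [ROOT-DECOMP decomp-kz gen 0 · node E piece A · tag WEAKER — S ⟹ A by
`finiteDefect_of_summit` (F = ∅; HOME/decomp-kz-lens-5/FiniteDefect.lean v1.2 sha256
f11629bd7a3275ada2561398819509ef3eee0cb76011ed1c21d1b48e399f74d4 (v1 a75b2585…, v1.1 a3f1e742…;
pieces byte-identical across versions)); A ⟹ S NOT known and not ring-theoretic (lens square-zero
model P_num ⋉ ℚ̄ε has A, ¬S, ¬B [hand]); BC2 probe A → S FAILS; coefficient boundary confirmed by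
the critic: the ℤ- and ℚ-coefficient finite-range versions are ≡ S (lens no-go
`summit_iff_finitelyManyMasterIdentities` PROVED; census NOT-WEAKER list, critic w4), Kpt ≅ ℚ̄ ∩ ℝ
is the first honest coefficient ring · NECESSARY (binder hA of `closes`; hA supplies the
module-finite defect) · NEW · kernel identity of record: A ⟹ TorsionDefect
(`critic_torsion_of_finiteDefect`, lens v1.2 `torsionDefect_of_finiteDefect` = the Cayley–Hamilton
half) ⟸ item stmt-KontsevichZagierPeriods-0541 PiLocalKernel (`torsionDefect_of_piLocalKernel`, p =
X^N), and S ⟺ TorsionDefect ∧ ElementaryCancellation (`critic_node_iff_torsion` /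
`summit_iff_torsionSplit`) — the 2×2 square with AyoubSpecialisation (S ⟺ 0541 ∧ 0540); lens answer
to w3: attackable feede -/
@[route_item "route-KontsevichZagierPeriods-RootDecompFiniteDefect", crux]
def FiniteDefect : Prop :=
  ∃ F : Finset Literature.NumberTheory.Transcendental.KZ.FormalPeriodRing, (∀ f ∈ F, Literature.NumberTheory.Transcendental.KZ.evalP f = 0) ∧ ∀ x : Literature.NumberTheory.Transcendental.KZ.FormalPeriodRing, Literature.NumberTheory.Transcendental.KZ.evalP x = 0 → x ∈ Submodule.span (Subring.closure {y : Literature.NumberTheory.Transcendental.KZ.FormalPeriodRing | ∃ (α : ℝ) (hα : IsAlgebraic ℚ α), y = Literature.NumberTheory.Transcendental.KZ.toFormalPeriod (Literature.NumberTheory.Transcendental.KZ.of (Literature.NumberTheory.Transcendental.KZ.IntegralRep.unit.constMul α hα))}) (F : Set Literature.NumberTheory.Transcendental.KZ.FormalPeriodRing)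

/-- item stmt-KontsevichZagierPeriods-25043 · crux · rank 3 · open · by planner
why it might fail: fails only with the summit (S ⟹ it, elementaryCancellation_of_summit); as a target its first instance ⟦π⟧·x = 0 ⟹ x = 0 is the open hard core 0540: a certificate for π·x ∼ 0 may use the extra dimension essentially, with no π-free certificate of bounded excursion.
sources: KontsevichZagier2001, stmt-KontsevichZagierPeriods-0540, BakerTNT1975, HuberMullerStach2017
[crux] [ROOT-DECOMP decomp-kz gen 0 · node E piece B · tag WEAKER — S ⟹ B by
`elementaryCancellation_of_summit`; B ⟹ KZ.PiCancellation = item stmt-KontsevichZagierPeriods-0540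
(registered hard core «Ayoub π-cancellation») by `piCancellation_of_elementaryCancellation`;
SoloBlind (C) ⟹ B; B ⟹ S NOT known; BC2 probe B → S FAILS · NECESSARY (binder hB; hB kills the
module-finite defect p(⟦π⟧)·ker = 0 produced by Cayley–Hamilton + Lindemann) · NEW as typed · leaf
IDEA-NEEDED (hard-core class 0540 / stubPiCancellation / betaCancellation rungs) · verdict: critic
decomp-kz-crit-1 CLEARED v1 2026-08-30T01:43:51Z and CONFIRMED v1.1 2026-08-30T01:44:38Z
(HOME/STATUS.md; HOME/CRITIC-LEDGER.md row «lens-5 FiniteDefect v1»; probe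
HOME/critic/L5_FiniteDefect_v1_probe.lean rc 0, std axioms)] cancellation by elementary formal
periods: every y in the subring of P generated by the point classes and ⟦π⟧ = class of KZ.piRep (so
y = a polynomial in ⟦π⟧ with real-algebraic point-class coefficients) whose value evalP y is
non-zero is a non-zero-divisor of P: x·y = 0 ⟹ x = 0. Implied by SoloBlind's full cancellation (C);
implies KZ.PiCancellation (hard core stmt-KontsevichZagierPeriods-0540, the case y = ⟦ -/
@[route_item "route-KontsevichZagierPeriods-RootDecompFiniteDefect", crux]
def ElementaryCancellation : Prop :=
  ∀ y ∈ Subring.closure ({y : Literature.NumberTheory.Transcendental.KZ.FormalPeriodRing | ∃ (α : ℝ) (hα : IsAlgebraic ℚ α), y = Literature.NumberTheory.Transcendental.KZ.toFormalPeriod (Literature.NumberTheory.Transcendental.KZ.of (Literature.NumberTheory.Transcendental.KZ.IntegralRep.unit.constMul α hα))} ∪ {Literature.NumberTheory.Transcendental.KZ.toFormalPeriod (Literature.NumberTheory.Transcendental.KZ.of Literature.NumberTheory.Transcendental.KZ.piRep)}), Literature.NumberTheory.Transcendental.KZ.evalP y ≠ 0 → ∀ x : Literature.NumberTheory.Transcendental.KZ.FormalPeriodRing,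 x * y = 0 → x = 0

/-- item stmt-KontsevichZagierPeriods-25044 · assembly · rank 1 · open · by planner
sources: KontsevichZagier2001
[assembly] FiniteDefect → ElementaryCancellation → the summit statement (the schema's assembly item;
the deciding theorem is `closes` in glue.lean, self-contained, rc 0 on the mock render
bc/native_mock.lean). -/
@[route_item "route-KontsevichZagierPeriods-RootDecompFiniteDefect"]
def Assembly : Prop :=
  FiniteDefect → ElementaryCancellation → KontsevichZagierPeriods

/-! D-0027 §2.1 — DECIDING THEOREM (planner-authored via `route open/edit --closes-file`; by planner-decomp-kz-writer-1-g0-0 2026-08-30T02:16:17Z):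
its hypotheses are this route's items and its conclusion the sub-problem Statement (glue_lint), and it elaborates with this file. -/

@[closes "route-KontsevichZagierPeriods-RootDecompFiniteDefect"] theorem closes (hA : FiniteDefect) (hB : ElementaryCancellation) :
    _root_.KontsevichZagierPeriods := by
  -- THE SEAM (Cayley–Hamilton on the module-finite defect + Lindemann); self-contained copy of
  -- `injective_of_finiteDefect_of_elementaryCancellation` from the node file FiniteDefect.lean.
  have main : Function.Injective Literature.NumberTheory.Transcendental.KZ.evalP := by
    obtain ⟨F, hF0, hFspan⟩ := hA
    set Kpt : Subring Literature.NumberTheory.Transcendental.KZ.FormalPeriodRing := Subring.closure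
      {y : Literature.NumberTheory.Transcendental.KZ.FormalPeriodRing | ∃ (α : ℝ) (hα : IsAlgebraic ℚ α),
        y = Literature.NumberTheory.Transcendental.KZ.toFormalPeriod (Literature.NumberTheory.Transcendental.KZ.of (Literature.NumberTheory.Transcendental.KZ.IntegralRep.unit.constMul α hα))} with hKpt
    set PI : Literature.NumberTheory.Transcendental.KZ.FormalPeriodRing := Literature.NumberTheory.Transcendental.KZ.toFormalPeriod (Literature.NumberTheory.Transcendental.KZ.of Literature.NumberTheory.Transcendental.KZ.piRep) with hPI
    set Elem : Subring Literature.NumberTheory.Transcendental.KZ.FormalPeriodRing := Subring.closure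
      ({y : Literature.NumberTheory.Transcendental.KZ.FormalPeriodRing | ∃ (α : ℝ) (hα : IsAlgebraic ℚ α),
        y = Literature.NumberTheory.Transcendental.KZ.toFormalPeriod (Literature.NumberTheory.Transcendental.KZ.of (Literature.NumberTheory.Transcendental.KZ.IntegralRep.unit.constMul α hα))} ∪ {PI}) with hElem
    have hPIval : Literature.NumberTheory.Transcendental.KZ.evalP PI = Real.pi := by rw [hPI, Literature.NumberTheory.Transcendental.KZ.evalP_toFormalPeriod_of, Literature.NumberTheory.Transcendental.KZ.piRep_value]
    have hKalg : ∀ x ∈ Kpt, Literature.NumberTheory.Transcendental.KZ.evalP x ∈ (Subalgebra.algebraicClosure ℚ ℝ).toSubring := by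
      have hle : Kpt ≤ (Subalgebra.algebraicClosure ℚ ℝ).toSubring.comap Literature.NumberTheory.Transcendental.KZ.evalP := by
        rw [hKpt]
        refine Subring.closure_le.mpr ?_
        rintro x ⟨α, hα, rfl⟩
        show IsAlgebraic ℚ (Literature.NumberTheory.Transcendental.KZ.evalP (Literature.NumberTheory.Transcendental.KZ.toFormalPeriod (Literature.NumberTheory.Transcendental.KZ.of (Literature.NumberTheory.Transcendental.KZ.IntegralRep.unit.constMul α hα))))
        rw [Literature.NumberTheory.Transcendental.KZ.evalP_toFormalPeriod_of, Literature.NumberTheory.Transcendental.KZ.IntegralRep.value_constMul, Literature.NumberTheory.Transcendental.KZ.IntegralRep.value_unit, mul_one]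
        exact hα
      exact fun x hx => hle hx
    have hKE : Kpt ≤ Elem := by
      rw [hKpt, hElem]; exact Subring.closure_mono Set.subset_union_left
    have hPIE : PI ∈ Elem := by
      rw [hElem]; exact Subring.subset_closure (Set.mem_union_right _ (Set.mem_singleton _))
    -- (1) Cayley–Hamilton bookkeeping: `q((a·)|_N)` acts as multiplication by `q(a)`
    have coe_aeval : ∀ (N : Submodule Kpt Literature.NumberTheory.Transcendental.KZ.FormalPeriodRing) (a : Literature.NumberTheory.Transcendental.KZ.FormalPeriodRing)
        (ha : ∀ x ∈ N, (LinearMap.mulLeft Kpt a) x ∈ N) (q : Polynomial Kpt) (y : N),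
        ((Polynomial.aeval ((LinearMap.mulLeft Kpt a).restrict ha) q) y : Literature.NumberTheory.Transcendental.KZ.FormalPeriodRing) =
          Polynomial.aeval a q * (y : Literature.NumberTheory.Transcendental.KZ.FormalPeriodRing) := by
      intro N a ha q
      have hpow : ∀ (n : ℕ) (z : N),
          ((((LinearMap.mulLeft Kpt a).restrict ha) ^ n) z : Literature.NumberTheory.Transcendental.KZ.FormalPeriodRing) =
            a ^ n * (z : Literature.NumberTheory.Transcendental.KZ.FormalPeriodRing) := by
        intro n
        induction n with
        | zero => intro z; simp
        | succ n ih =>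
          intro z
          rw [pow_succ', Module.End.mul_apply, LinearMap.coe_restrict_apply, LinearMap.mulLeft_apply,
            ih, ← mul_assoc, ← pow_succ']
      induction q using Polynomial.induction_on' with
      | add p q hp hq =>
        intro y
        rw [map_add, LinearMap.add_apply, Submodule.coe_add, hp, hq, map_add, add_mul]
      | monomial n c =>
        intro y
        rw [Polynomial.aeval_monomial, Polynomial.aeval_monomial, Module.End.mul_apply, Module.algebraMap_end_apply,
          Submodule.coe_smul, hpow, Algebra.smul_def, mul_assoc]
    -- (2) Cayley–Hamilton: a monic annihilator of an `a`-stable module-finite submodule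
    have annih : ∀ (N : Submodule Kpt Literature.NumberTheory.Transcendental.KZ.FormalPeriodRing), Module.Finite Kpt N →
        ∀ a : Literature.NumberTheory.Transcendental.KZ.FormalPeriodRing, (∀ x ∈ N, a * x ∈ N) →
        ∃ p : Polynomial Kpt, p.Monic ∧ ∀ x ∈ N, Polynomial.aeval a p * x = 0 := by
      intro N hN a ha
      have ha' : ∀ x ∈ N, (LinearMap.mulLeft Kpt a) x ∈ N := fun x hx => by
        rw [LinearMap.mulLeft_apply]; exact ha x hx
      obtain ⟨p, hp, hfp⟩ :=
        LinearMap.exists_monic_and_aeval_eq_zero Kpt ((LinearMap.mulLeft Kpt a).restrict ha')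
      refine ⟨p, hp, fun x hx => ?_⟩
      have h := coe_aeval N a ha' p ⟨x, hx⟩
      rw [hfp, LinearMap.zero_apply, Submodule.coe_zero] at h
      exact h.symm
    -- (3) Lindemann: a monic polynomial over the point classes does not vanish at `⟦π⟧`
    have lind : ∀ p : Polynomial Kpt, p.Monic → Literature.NumberTheory.Transcendental.KZ.evalP (Polynomial.aeval PI p) ≠ 0 := by
      intro p hp
      have hπ : Transcendental ℚ Real.pi := Literature.NumberTheory.Transcendental.transcendental_pi_holds
      have hπK : Transcendental (Subalgebra.algebraicClosure ℚ ℝ) Real.pi :=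
        hπ.subalgebraAlgebraicClosure
      let φ : Kpt →+* (Subalgebra.algebraicClosure ℚ ℝ) :=
        Literature.NumberTheory.Transcendental.KZ.evalP.restrict Kpt (Subalgebra.algebraicClosure ℚ ℝ).toSubring hKalg
      intro h0
      apply hπK
      refine ⟨p.map φ, (hp.map φ).ne_zero, ?_⟩
      have hcomp : (algebraMap (Subalgebra.algebraicClosure ℚ ℝ) ℝ).comp φ =
          Literature.NumberTheory.Transcendental.KZ.evalP.comp (algebraMap Kpt Literature.NumberTheory.Transcendental.KZ.FormalPeriodRing) := by
        ext x
        rfl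
      rw [Polynomial.aeval_def, Polynomial.eval₂_map, hcomp, ← hPIval, ← Polynomial.hom_eval₂, ← Polynomial.aeval_def]
      exact h0
    -- (4) polynomials in `⟦π⟧` over the point classes are elementary
    have elem : ∀ p : Polynomial Kpt, Polynomial.aeval PI p ∈ Elem := by
      intro p
      induction p using Polynomial.induction_on' with
      | add p q hp hq => rw [map_add]; exact Subring.add_mem _ hp hq
      | monomial n c =>
        rw [Polynomial.aeval_monomial]
        exact Subring.mul_mem _ (hKE c.2) (Subring.pow_mem _ hPIE n)
    -- (5) the seam
    set N : Submodule Kpt Literature.NumberTheory.Transcendental.KZ.FormalPeriodRing := Submodule.span Kpt (F : Set Literature.NumberTheory.Transcendental.KZ.FormalPeriodRing) with hN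
    have hNker : ∀ x ∈ N, Literature.NumberTheory.Transcendental.KZ.evalP x = 0 := by
      intro x hx
      induction hx using Submodule.span_induction with
      | mem f hf => exact hF0 f hf
      | zero => exact map_zero _
      | add x y _ _ hx hy => rw [map_add, hx, hy, add_zero]
      | smul r x _ hx => rw [Algebra.smul_def, map_mul, hx, mul_zero]
    have hstab : ∀ x ∈ N, PI * x ∈ N := fun x hx =>
      hFspan _ (by rw [map_mul, hNker x hx, mul_zero])
    have hfin : Module.Finite Kpt N := Module.Finite.span_of_finite Kpt F.finite_toSet
    obtain ⟨p, hp, hkill⟩ := annih N hfin PI hstab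
    rw [injective_iff_map_eq_zero]
    intro x hx
    exact hB _ (elem p) (lind p hp) x (by rw [mul_comm]; exact hkill x (hFspan x hx))
  -- the cited frame: `S ↔ ker eval = relations ↔ evalP injective`
  rw [KontsevichZagierPeriods_iff,
    ← Literature.NumberTheory.Transcendental.kzKernelConjecture_iff_isRational]
  intro c hc
  apply Literature.NumberTheory.Transcendental.KZ.toFormalPeriod_eq_zero_iff.mp
  apply main
  rw [Literature.NumberTheory.Transcendental.KZ.evalP_toFormalPeriod, map_zero]
  exact hc

end Summit.KontsevichZagierPeriods.KontsevichZagierPeriods.Theses.RootDecompFiniteDefect
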